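import Summits.QuantumFields.YangMills.Theorems.ColdStartUniversalityLatticeLangevinMeasurableFlow
import Summits.QuantumFields.YangMills.Theorems.ColdStartUniversalityLatticeLangevinLawUniqueStart
import Summits.QuantumFields.YangMills.Theorems.ColdStartUniversalityUniformColdStartMixingRungOfHarris
import HarnessLib

/-!
# Route `ColdStartUniversality` (rung input (M), crux K_A1 stmt-QuantumFields-24809): CHAPMAN–KOLMOGOROV for the
# SZZ transition kernels ⇐ the FLOW (COCYCLE) PROPERTY of the canonical solution family

Helper file (seat `ym-line-csu-p1`, g4).  Hypothesis (CK) of `…UniformColdStartMixingRungOfHarris` — the transition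
kernels `κ_t(x,·) = law(U^x_t)` of the SU(2) Shen–Zhu–Zhu dynamics form a semigroup, `κ_{s+t} = κ_t ∘ₖ κ_s` — is
reduced, KERNEL-CHECKED, to Kunita's flow property of ONE jointly measurable solution family `U` on the canonical
space of continuous paths (`Ωc = {p : ℝ≥0 → ℝ^{E × NoiseIdx} // continuous, p 0 = 0}`, law of a flat Brownian motion,
coordinate process): `U x (s+t) p = U (U x s p) t (θ_s p)` a.s., `θ_s p = p(s + ·) − p(s)` the shifted path
(`chapmanKolmogorov_of_cocycle`).  Ingredients, all proved here: the shift of a flat Brownian motion is a flat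
Brownian motion (`isFlatBrownian_shift`), the shifted path has the canonical law (`map_shiftPath_eq`) and is
independent of the past (`indepFun_shiftPath_of_measurable`), and the freezing lemma of the tree
(`IsBrownianVec.integral_comp_eq_integral_integral_of_indepFun`).

With `…RungOfHarris`: rung `stub_fixedCutoffMixing` ⇐ (cocycle of the canonical flow) ∧ (D) Doeblin ∧ the named fact
`WilsonMeasureLangevinInvariant`.  The cocycle itself (restart of strong solutions with fresh noise; Kunita 1984 Ch. II
Thm 3.1-type) is NOT proved here.  No definition, no sorry.  RECORD-rung R3 plumbing; nothing here bears on the mass gap.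
-/

set_option autoImplicit false

noncomputable section

namespace Summit.QuantumFields.YangMills.Theorems.ColdStartUniversality

open MeasureTheory ProbabilityTheory Filter Topology
open scoped NNReal ENNReal BigOperators
open Literature.Probability.Process Literature.MathematicalPhysics.QuantumFieldTheory
open Literature.MathematicalPhysics.QuantumLattice (fundamentalRep fundamentalLatticeRep continuous_fundamentalRep)

/-! ## Shifting a flat Brownian motion -/

section Shift

variable {Ω : Type*} {mΩ : MeasurableSpace Ω} {P : Measure Ω} {d L : ℕ} [NeZero L] {ι : Type*} [Fintype ι]
  {W : ℝ≥0 → Ω → (Edge d L × ι → ℝ)}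

/-- **The shifted process `u ↦ W_{s+u} − W_s` of a flat Brownian motion is a flat Brownian motion** (simple Markov
property: independence of the further shifts from the past of `W`, stationarity of the increments).
[cite: Legall2016, Ch. 2 (simple Markov property)] -/
theorem isFlatBrownian_shift (hW : IsFlatBrownian W P) (s : ℝ≥0) :
    IsFlatBrownian (fun u ω => W (s + u) ω - W s ω) P := by
  -- the enumerated vector processes
  set V : ℝ≥0 → Ω → (Fin (Fintype.card (Edge d L × ι)) → ℝ) :=
    fun t ω k => W t ω ((Fintype.equivFin (Edge d L × ι)).symm k) with hV
  have hVb : IsBrownianVec V P := hW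
  have hV' : (fun t ω k => (W (s + t) ω - W s ω) ((Fintype.equivFin (Edge d L × ι)).symm k)) =
      fun t ω => vecShift V s ω t := by
    funext t ω k
    simp [vecShift, hV]
  change IsBrownianVec (fun t ω k => (W (s + t) ω - W s ω) ((Fintype.equivFin (Edge d L × ι)).symm k)) P
  rw [hV']
  have hshift : ∀ s' : ℝ≥0, vecShift (fun t ω => vecShift V s ω t) s' = vecShift V (s + s') := by
    intro s'
    funext ω u
    simp only [vecShift, add_assoc]
    abel
  have hpath : vecPath (fun t ω => vecShift V s ω t) = vecShift V s := rfl
  -- the past of the shifted process factors through the past of `V` at time `s + s'`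
  have hpast : ∀ s' : ℝ≥0, MeasurableSpace.comap (vecPast (fun t ω => vecShift V s ω t) s') inferInstance ≤
      hVb.natFiltration (s + s') := by
    intro s'
    set Φ : (Set.Iic (s + s') → (Fin (Fintype.card (Edge d L × ι)) → ℝ)) →
        (Set.Iic s' → (Fin (Fintype.card (Edge d L × ι)) → ℝ)) :=
      fun f r => f ⟨s + r, Set.mem_Iic.2 (add_le_add_right (Set.mem_Iic.1 r.2) s)⟩ -
        f ⟨s, Set.mem_Iic.2 le_self_add⟩ with hΦ
    have hΦm : Measurable Φ :=
      measurable_pi_lambda _ fun r => (measurable_pi_apply _).sub (measurable_pi_apply _)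
    have hfac : vecPast (fun t ω => vecShift V s ω t) s' = Φ ∘ vecPast V (s + s') := by
      funext ω r
      simp [vecPast, vecShift, hΦ]
    rw [hVb.natFiltration_eq_comap_vecPast (s + s'), hfac, ← MeasurableSpace.comap_comp]
    exact MeasurableSpace.comap_mono (measurable_iff_comap_le.1 hΦm)
  have hmapshift : ∀ s' : ℝ≥0, P.map (vecShift (fun t ω => vecShift V s ω t) s') =
      P.map (vecPath (fun t ω => vecShift V s ω t)) := by
    intro s'
    rw [hshift s', hpath, hVb.map_shift (s + s'), ← hVb.map_shift s]
  have hmapt : ∀ t : ℝ≥0, P.map (fun ω => vecShift V s ω t) = gaussVec (Fintype.card (Edge d L × ι)) t :=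
    fun t => hVb.map_incr s t
  refine ⟨fun t => (hVb.measurable (s + t)).sub (hVb.measurable s), fun ω => ?_, fun ω => ?_,
    fun s' => ?_, hmapshift, hmapt⟩
  · exact ((hVb.continuous_path ω).comp (continuous_const.add continuous_id)).sub continuous_const
  · simp [vecShift]
  · rw [IndepFun_iff_Indep, hshift s']
    exact indep_of_indep_of_le_right (hVb.indep_comap_vecShift_natFiltration (s + s')) (hpast s')

/-- Paths of the shifted process are continuous and start at `0`. [folklore] -/
theorem continuous_shiftPath_and_zero (hW : IsFlatBrownian W P) (s : ℝ≥0) (ω : Ω) :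
    Continuous (fun u => W (s + u) ω - W s ω) ∧ W (s + 0) ω - W s ω = 0 := by
  refine ⟨?_, by rw [add_zero, sub_self]⟩
  have hc : Continuous fun t => W t ω := continuous_pi fun i => continuous_flatCoord hW i ω
  exact (hc.comp (continuous_const.add continuous_id)).sub continuous_const

end Shift

/-! ## The shifted path on the canonical space: law and independence from the past -/

section Canonical

variable {Ω : Type*} {mΩ : MeasurableSpace Ω} {P : Measure Ω} {L : ℕ} [NeZero L]
  {W : ℝ≥0 → Ω → (Edge 3 L × NoiseIdx 2 → ℝ)}

/-- **The shifted path has the canonical law**: the image of `P` under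
`ω ↦ (u ↦ W_{s+u}(ω) − W_s(ω))` on the space of continuous paths equals the image under the path map itself
(both are flat Brownian motions; `map_pathMap_eq`). [folklore] -/
theorem map_shiftPath_eq [IsProbabilityMeasure P] (hW : IsFlatBrownian W P) (s : ℝ≥0) :
    P.map (fun ω => (⟨fun u => W (s + u) ω - W s ω, continuous_shiftPath_and_zero hW s ω⟩ :
        {p : ℝ≥0 → (Edge 3 L × NoiseIdx 2 → ℝ) // Continuous p ∧ p 0 = 0})) =
      P.map (fun ω => (⟨fun t => W t ω, continuous_path_and_zero hW ω⟩ :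
        {p : ℝ≥0 → (Edge 3 L × NoiseIdx 2 → ℝ) // Continuous p ∧ p 0 = 0})) :=
  map_pathMap_eq (isFlatBrownian_shift hW s) hW

/-- **The shifted path is independent of the past**: for `Y` measurable with respect to the natural filtration of
`W` at time `s`, `Y` and `ω ↦ (u ↦ W_{s+u}(ω) − W_s(ω))` are independent. [cite: Legall2016, Ch. 2 (simple Markov property)] -/
theorem indepFun_shiftPath_of_measurable [IsProbabilityMeasure P] (hW : IsFlatBrownian W P) (s : ℝ≥0)
    {X : Type*} [MeasurableSpace X] {Y : Ω → X} (hY : Measurable[hW.natFiltration s] Y) :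
    IndepFun Y (fun ω => (⟨fun u => W (s + u) ω - W s ω, continuous_shiftPath_and_zero hW s ω⟩ :
        {p : ℝ≥0 → (Edge 3 L × NoiseIdx 2 → ℝ) // Continuous p ∧ p 0 = 0})) P := by
  set V : ℝ≥0 → Ω → (Fin (Fintype.card (Edge 3 L × NoiseIdx 2)) → ℝ) :=
    fun t ω k => W t ω ((Fintype.equivFin (Edge 3 L × NoiseIdx 2)).symm k) with hV
  have hVb : IsBrownianVec V P := hW
  have hind := hVb.indep_comap_vecShift_natFiltration s
  -- the σ-algebra of the shifted path is contained in `σ(vecShift V s)`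
  have hθ : MeasurableSpace.comap (fun ω => (⟨fun u => W (s + u) ω - W s ω, continuous_shiftPath_and_zero hW s ω⟩ :
        {p : ℝ≥0 → (Edge 3 L × NoiseIdx 2 → ℝ) // Continuous p ∧ p 0 = 0})) inferInstance ≤
      MeasurableSpace.comap (vecShift V s) inferInstance := by
    set Ψ : (ℝ≥0 → (Fin (Fintype.card (Edge 3 L × NoiseIdx 2)) → ℝ)) → (ℝ≥0 → (Edge 3 L × NoiseIdx 2 → ℝ)) :=
      fun q u i => q u (Fintype.equivFin (Edge 3 L × NoiseIdx 2) i) with hΨ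
    have hΨm : Measurable Ψ :=
      measurable_pi_lambda _ fun u => measurable_pi_lambda _ fun i => (measurable_pi_apply _).comp (measurable_pi_apply u)
    have hfac : (Subtype.val ∘ fun ω => (⟨fun u => W (s + u) ω - W s ω, continuous_shiftPath_and_zero hW s ω⟩ :
        {p : ℝ≥0 → (Edge 3 L × NoiseIdx 2 → ℝ) // Continuous p ∧ p 0 = 0})) = Ψ ∘ vecShift V s := by
      funext ω u i
      simp [vecShift, hV, hΨ]
    -- the subtype σ-algebra is the comap of the ambient one under `Subtype.val`
    change MeasurableSpace.comap _ (MeasurableSpace.comap Subtype.val inferInstance) ≤ _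
    rw [MeasurableSpace.comap_comp, hfac, ← MeasurableSpace.comap_comp]
    exact MeasurableSpace.comap_mono (measurable_iff_comap_le.1 hΨm)
  have hYle : MeasurableSpace.comap Y inferInstance ≤ hVb.natFiltration s := by
    have h := measurable_iff_comap_le.1 hY
    rwa [natFiltration_flat_eq hW] at h
  rw [IndepFun_iff_Indep]
  exact indep_of_indep_of_le_right (indep_of_indep_of_le_left hind.symm hYle) hθ

end Canonical

/-! ## Chapman–Kolmogorov from the cocycle property of the canonical flow -/

section CK

variable {L : ℕ} [NeZero L]

/-- **(CK) ⇐ cocycle.**  Let `U` be a solution family of the SU(2) SZZ dynamics at coupling `β'` on the canonical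
continuous-path space (law `Pc` of a flat Brownian motion, coordinate process), from every start, jointly measurable
in (start, path) at each time, with the FLOW PROPERTY `U x (s+t) p = U (U x s p) t (θ_s p)` for `Pc`-a.e. `p`
(`θ_s p = p(s+·) − p(s)`).  Then every Markov kernel family realising the transition laws satisfies Chapman–Kolmogorov
`κ (s+t) = κ t ∘ₖ κ s` (freezing the `𝓕_s`-measurable start `U x s` against the independent shifted path, whose law
is `Pc`). [cite: Kunita1984, Ch. II §2–3 (stochastic flows)] -/
theorem chapmanKolmogorov_of_cocycle (β' : ℝ)
    {Ω : Type} [MeasurableSpace Ω] {P : Measure Ω} [IsProbabilityMeasure P]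
    {W : ℝ≥0 → Ω → (Edge 3 L × NoiseIdx 2 → ℝ)} (hW : IsFlatBrownian W P)
    (U : GaugeConfig 3 L (Matrix.specialUnitaryGroup (Fin 2) ℂ) → ℝ≥0 →
      {p : ℝ≥0 → (Edge 3 L × NoiseIdx 2 → ℝ) // Continuous p ∧ p 0 = 0} →
      GaugeConfig 3 L (Matrix.specialUnitaryGroup (Fin 2) ℂ))
    (hU : ∀ x, (∀ p, U x 0 p = x) ∧
      (latticeLangevinDynamics (fundamentalLatticeRep 2) β').IsSolution (fundamentalRep (Fin 2))
        (isFlatBrownian_canonical hW).natFiltration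
        (P.map (fun ω => (⟨fun t => W t ω, continuous_path_and_zero hW ω⟩ :
          {p : ℝ≥0 → (Edge 3 L × NoiseIdx 2 → ℝ) // Continuous p ∧ p 0 = 0})))
        (fun (t : ℝ≥0) (p : {p : ℝ≥0 → (Edge 3 L × NoiseIdx 2 → ℝ) // Continuous p ∧ p 0 = 0}) => p.1 t) (U x))
    (hmeas : ∀ t, Measurable fun q : GaugeConfig 3 L (Matrix.specialUnitaryGroup (Fin 2) ℂ) ×
      {p : ℝ≥0 → (Edge 3 L × NoiseIdx 2 → ℝ) // Continuous p ∧ p 0 = 0} => U q.1 t q.2)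
    (hcoc : ∀ (x : GaugeConfig 3 L (Matrix.specialUnitaryGroup (Fin 2) ℂ)) (s t : ℝ≥0),
      ∀ᵐ p ∂(P.map (fun ω => (⟨fun t => W t ω, continuous_path_and_zero hW ω⟩ :
          {p : ℝ≥0 → (Edge 3 L × NoiseIdx 2 → ℝ) // Continuous p ∧ p 0 = 0}))),
        U x (s + t) p = U (U x s p) t ⟨fun u => p.1 (s + u) - p.1 s,
          continuous_shiftPath_and_zero (isFlatBrownian_canonical hW) s p⟩)
    (κ : ℝ≥0 → Kernel (GaugeConfig 3 L (Matrix.specialUnitaryGroup (Fin 2) ℂ))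
      (GaugeConfig 3 L (Matrix.specialUnitaryGroup (Fin 2) ℂ))) [∀ t, IsMarkovKernel (κ t)]
    (hreal : ∀ (t : ℝ≥0) (x : GaugeConfig 3 L (Matrix.specialUnitaryGroup (Fin 2) ℂ))
        (Ω' : Type) [MeasurableSpace Ω'] (P' : Measure Ω') [IsProbabilityMeasure P']
        (W' : ℝ≥0 → Ω' → (Edge 3 L × NoiseIdx 2 → ℝ)) (hW' : IsFlatBrownian W' P')
        (U' : ℝ≥0 → Ω' → GaugeConfig 3 L (Matrix.specialUnitaryGroup (Fin 2) ℂ)),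
        (∀ ω, U' 0 ω = x) →
        (latticeLangevinDynamics (fundamentalLatticeRep 2) β').IsSolution (fundamentalRep (Fin 2))
          hW'.natFiltration P' W' U' →
        κ t x = P'.map (U' t))
    (s t : ℝ≥0) : κ (s + t) = κ t ∘ₖ κ s := by
  classical
  -- abbreviations for the canonical data
  set Pc : Measure {p : ℝ≥0 → (Edge 3 L × NoiseIdx 2 → ℝ) // Continuous p ∧ p 0 = 0} :=
    P.map (fun ω => (⟨fun t => W t ω, continuous_path_and_zero hW ω⟩ :
      {p : ℝ≥0 → (Edge 3 L × NoiseIdx 2 → ℝ) // Continuous p ∧ p 0 = 0})) with hPc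
  haveI : IsProbabilityMeasure Pc := Measure.isProbabilityMeasure_map (measurable_pathMap hW).aemeasurable
  have hWc := isFlatBrownian_canonical hW
  set θ : {p : ℝ≥0 → (Edge 3 L × NoiseIdx 2 → ℝ) // Continuous p ∧ p 0 = 0} →
      {p : ℝ≥0 → (Edge 3 L × NoiseIdx 2 → ℝ) // Continuous p ∧ p 0 = 0} :=
    fun p => ⟨fun u => p.1 (s + u) - p.1 s, continuous_shiftPath_and_zero hWc s p⟩ with hθ
  have hθm : Measurable θ := (measurable_pi_lambda _ fun u => ((isFlatBrownian_shift hWc s).measurable u)).subtype_mk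
  have hθlaw : Pc.map θ = Pc := by
    rw [hθ, map_shiftPath_eq hWc s]
    -- the path map of the coordinate process is the identity
    have hid : (fun p : {p : ℝ≥0 → (Edge 3 L × NoiseIdx 2 → ℝ) // Continuous p ∧ p 0 = 0} =>
        (⟨fun t => p.1 t, continuous_path_and_zero hWc p⟩ :
          {p : ℝ≥0 → (Edge 3 L × NoiseIdx 2 → ℝ) // Continuous p ∧ p 0 = 0})) = id := by
      funext p
      exact Subtype.ext rfl
    rw [hid, Measure.map_id]
  have hmU : ∀ x u, Measurable (U x u) := fun x u => ((hU x).2.adapted u).mono (hWc.natFiltration.le u) le_rfl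
  -- the kernels in the canonical realisation
  have hκ : ∀ u x, κ u x = Pc.map (U x u) := fun u x =>
    hreal u x _ Pc _ hWc (U x) (hU x).1 (hU x).2
  -- compare on measurable sets
  ext x A hA
  rw [Kernel.comp_apply' _ _ _ hA, hκ (s + t) x, Measure.map_apply (hmU x (s + t)) hA, hκ s x]
  -- left side: cocycle, then freezing
  have hY : Measurable[hWc.natFiltration s] (U x s) := (hU x).2.adapted s
  have hind := indepFun_shiftPath_of_measurable hWc s hY
  set g : GaugeConfig 3 L (Matrix.specialUnitaryGroup (Fin 2) ℂ) ×
      {p : ℝ≥0 → (Edge 3 L × NoiseIdx 2 → ℝ) // Continuous p ∧ p 0 = 0} → ℝ :=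
    fun q => A.indicator (fun _ => (1 : ℝ)) (U q.1 t q.2) with hg
  have hgm : Measurable g := (measurable_const.indicator hA).comp (hmeas t)
  have hgb : ∀ q, |g q| ≤ 1 := fun q => by
    simp only [hg]
    by_cases h : U q.1 t q.2 ∈ A <;> simp [h]
  have hfreeze := IsBrownianVec.integral_comp_eq_integral_integral_of_indepFun (hmU x s) hθm hind hgm hgb
  rw [hθlaw] at hfreeze
  -- `Pc (U x (s+t) ⁻¹' A)` as an integral of `g (U x s p, θ p)`
  have hL : (Pc (U x (s + t) ⁻¹' A)).toReal = ∫ p, g (U x s p, θ p) ∂Pc := by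
    have hset : Pc (U x (s + t) ⁻¹' A) = Pc ((fun p => U (U x s p) t (θ p)) ⁻¹' A) :=
      measure_congr ((hcoc x s t).mono fun p hp => by
        show (U x (s + t) p ∈ A) = (U (U x s p) t (θ p) ∈ A)
        exact congrArg (· ∈ A) hp)
    have hm2 : Measurable fun p => U (U x s p) t (θ p) := by
      have h := (hmeas t).comp ((hmU x s).prodMk hθm)
      exact h
    rw [hset, ← measureReal_def, ← mul_one (Pc.real _), ← smul_eq_mul, ← setIntegral_const,
      ← integral_indicator (hm2 hA)]
    rfl
  -- the inner integral is the kernel `κ t` at the frozen start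
  have hR : ∀ y, ∫ e, g (y, e) ∂Pc = (κ t y A).toReal := by
    intro y
    rw [hκ t y, Measure.map_apply (hmU y t) hA, ← measureReal_def, ← mul_one (Pc.real _), ← smul_eq_mul,
      ← setIntegral_const, ← integral_indicator (hmU y t hA)]
    rfl
  simp_rw [hR] at hfreeze
  -- assemble
  have hfin : ∫⁻ y, κ t y A ∂(Pc.map (U x s)) ≠ ∞ := by
    refine ne_top_of_le_ne_top (measure_ne_top (Pc.map (U x s)) Set.univ) ?_
    calc ∫⁻ y, κ t y A ∂(Pc.map (U x s)) ≤ ∫⁻ _y, 1 ∂(Pc.map (U x s)) := lintegral_mono fun y => prob_le_one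
      _ = _ := by rw [lintegral_const, one_mul]
  refine (ENNReal.toReal_eq_toReal_iff' (measure_ne_top _ _) hfin).1 ?_
  rw [hL, hfreeze, ← integral_toReal ((κ t).measurable_coe hA).aemeasurable
    (Eventually.of_forall fun y => measure_lt_top (κ t y) A),
    integral_map (hmU x s).aemeasurable]
  exact ((κ t).measurable_coe hA).ennreal_toReal.aestronglyMeasurable

/-- **The rung `stub_fixedCutoffMixing` from the flow property, a Doeblin minorisation and the named fact
`WilsonMeasureLangevinInvariant`**: `fixedCutoffMixing_of_harris` with its Chapman–Kolmogorov hypothesis discharged by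
`chapmanKolmogorov_of_cocycle` from the cocycle property of a jointly measurable solution family on the canonical space
(law of the product-Wiener coordinate process). [folklore] -/
theorem fixedCutoffMixing_of_cocycle
    (hCoc : ∀ (L : ℕ) [NeZero L] (β' : ℝ) (Ω : Type) [MeasurableSpace Ω] (P : Measure Ω) [IsProbabilityMeasure P]
      (W : ℝ≥0 → Ω → (Edge 3 L × NoiseIdx 2 → ℝ)) (hW : IsFlatBrownian W P),
      ∃ U : GaugeConfig 3 L (Matrix.specialUnitaryGroup (Fin 2) ℂ) → ℝ≥0 →
          {p : ℝ≥0 → (Edge 3 L × NoiseIdx 2 → ℝ) // Continuous p ∧ p 0 = 0} →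
          GaugeConfig 3 L (Matrix.specialUnitaryGroup (Fin 2) ℂ),
        (∀ x, (∀ p, U x 0 p = x) ∧
          (latticeLangevinDynamics (fundamentalLatticeRep 2) β').IsSolution (fundamentalRep (Fin 2))
            (isFlatBrownian_canonical hW).natFiltration
            (P.map (fun ω => (⟨fun t => W t ω, continuous_path_and_zero hW ω⟩ :
              {p : ℝ≥0 → (Edge 3 L × NoiseIdx 2 → ℝ) // Continuous p ∧ p 0 = 0})))
            (fun (t : ℝ≥0) (p : {p : ℝ≥0 → (Edge 3 L × NoiseIdx 2 → ℝ) // Continuous p ∧ p 0 = 0}) => p.1 t)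
            (U x)) ∧
        (∀ t, Measurable fun q : GaugeConfig 3 L (Matrix.specialUnitaryGroup (Fin 2) ℂ) ×
          {p : ℝ≥0 → (Edge 3 L × NoiseIdx 2 → ℝ) // Continuous p ∧ p 0 = 0} => U q.1 t q.2) ∧
        ∀ (x : GaugeConfig 3 L (Matrix.specialUnitaryGroup (Fin 2) ℂ)) (s t : ℝ≥0),
          ∀ᵐ p ∂(P.map (fun ω => (⟨fun t => W t ω, continuous_path_and_zero hW ω⟩ :
              {p : ℝ≥0 → (Edge 3 L × NoiseIdx 2 → ℝ) // Continuous p ∧ p 0 = 0}))),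
            U x (s + t) p = U (U x s p) t ⟨fun u => p.1 (s + u) - p.1 s,
              continuous_shiftPath_and_zero (isFlatBrownian_canonical hW) s p⟩)
    (hD : ∀ (L : ℕ) [NeZero L] (β' : ℝ)
      (κ : ℝ≥0 → Kernel (GaugeConfig 3 L (Matrix.specialUnitaryGroup (Fin 2) ℂ))
        (GaugeConfig 3 L (Matrix.specialUnitaryGroup (Fin 2) ℂ))) [∀ t, IsMarkovKernel (κ t)],
      (∀ (t : ℝ≥0) (x : GaugeConfig 3 L (Matrix.specialUnitaryGroup (Fin 2) ℂ))
          (Ω : Type) [MeasurableSpace Ω] (P : Measure Ω) [IsProbabilityMeasure P]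
          (W : ℝ≥0 → Ω → (Edge 3 L × NoiseIdx 2 → ℝ)) (hW : IsFlatBrownian W P)
          (U : ℝ≥0 → Ω → GaugeConfig 3 L (Matrix.specialUnitaryGroup (Fin 2) ℂ)),
          (∀ ω, U 0 ω = x) →
          (latticeLangevinDynamics (fundamentalLatticeRep 2) β').IsSolution (fundamentalRep (Fin 2))
            hW.natFiltration P W U →
          κ t x = P.map (U t)) →
      ∃ (t₀ : ℝ≥0) (ν : Measure (GaugeConfig 3 L (Matrix.specialUnitaryGroup (Fin 2) ℂ))),
        ν ≠ 0 ∧ ∀ z, ν ≤ κ t₀ z)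
    (hWinv : ∀ (L : ℕ) [NeZero L] (β' : ℝ), WilsonMeasureLangevinInvariant (fundamentalLatticeRep 2) 3 L β') :
    ∀ (F : Balaban1983to89.T3ContinuumYM3Torus.T3Family) (γ : ℝ), 0 < γ →
      ∀ (os : List (Balaban1983to89.T3ContinuumYM3Torus.ULoop3 F)) (δ : ℝ), 0 < δ → ∀ K : ℕ, ∃ T : ℝ, 0 < T ∧
        ∀ (Ω : Type) (mΩ : MeasurableSpace Ω) (P : Measure Ω) (hP : IsProbabilityMeasure P)
          (W : ℝ≥0 → Ω → (Edge 3 ((F.P K).sitesPerDir 0) × NoiseIdx 2 → ℝ)) (hW : IsFlatBrownian W P)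
          (U : ℝ≥0 → Ω → GaugeConfig 3 ((F.P K).sitesPerDir 0) (Matrix.specialUnitaryGroup (Fin 2) ℂ)),
          (∀ ω, U 0 ω = fun _ => 1) →
          (latticeLangevinDynamics (fundamentalLatticeRep 2) ((γ * (F.P K).eps)⁻¹ / 2)).IsSolution
            (fundamentalRep (Fin 2)) hW.natFiltration P W U →
          |(F.scheme (Balaban1983to89.ExpMeanLog.expMeanLogSU :
                Balaban1983to89.LoopAverage (Matrix.specialUnitaryGroup (Fin 2) ℂ)) γ).expectAt K os -
              T⁻¹ * ∫ s in (0 : ℝ)..T, (∫ ω, (os.map fun C => F.avgObs (Balaban1983to89.ExpMeanLog.expMeanLogSU :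
                  Balaban1983to89.LoopAverage (Matrix.specialUnitaryGroup (Fin 2) ℂ)) K C
                (fun b : Balaban1983to89.PBond (F.P K) 0 => U (s / (F.P K).eps).toNNReal ω (b.src, b.dir))).prod ∂P)| ≤ δ := by
  refine fixedCutoffMixing_of_harris (fun L _ β' κ _ hreal => ?_) hD hWinv
  haveI := isProbabilityMeasure_piWiener (Edge 3 L × NoiseIdx 2)
  obtain ⟨U, hU, hm, hc⟩ := hCoc L β' _ (Measure.pi fun _ : Edge 3 L × NoiseIdx 2 => preWienerMeasure) _
    (isFlatBrownian_piWiener 3 L (NoiseIdx 2))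
  exact chapmanKolmogorov_of_cocycle β' (isFlatBrownian_piWiener 3 L (NoiseIdx 2)) U hU hm hc κ hreal

end CK

end Summit.QuantumFields.YangMills.Theorems.ColdStartUniversality

end
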